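import Literature.NumberTheory.GaloisCohomology.Howard2004.DVRSettingPiRefinementAssembly
import Literature.NumberTheory.GaloisCohomology.Howard2004.DVRSettingPiRefinementMorphismProofs
import HarnessLib

/-!
# The Kolyvagin system of the π-adically refined setting: the pushforward of `κ` along
# «`S` at its hosts» → `S♯` (Howard 2004, Rem. 1.2.4 and §1.6)

Topic `NumberTheory/GaloisCohomology/Howard2004`. Two definitions with bodies (`DVRSetting.refineHom`,
`DVRSetting.refinePushforward`) + theorems; no named fact, no instance, no notation, no `sorry`. Cell
`pub/bsd-print-x9`, print leaf G87 `Literature.NumberTheory.GaloisCohomology.Howard2004.thm161_dvrKolyvaginBound` (Howard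
Thm. 1.6.1); seat `bsd-line-x10b-p1` LEAD g12, brick «R7-KS» part B of the π-adic REFINEMENT programme (x10b-p1-w2
g16's `DVRSetting.refine` / `refine_satisfiesH`, p700932; part A `DVRSettingPiRefinementMorphismProofs`, p700895).

SOURCE. B. Howard, *The Heegner point Kolyvagin system*, Compositio Math. **140** (2004) = arXiv:1202.6340: Rem. 1.2.4
(`KS` is functorial in the ring and the module, p. 7 L13–27) and §1.6 «we obtain, by Remark (functorality), a
Kolyvagin system `κ^{(k)} ∈ KS(T^{(k)}, F, 𝓛^{(k)})`» (p. 11 L45–47), «`κ_1 ∈ H¹_F(K,T) = lim`» (p. 12 L29–33);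
Thm. 1.6.1's hypothesis «a Kolyvagin system `κ` with `κ_1 ≠ 0`» (p. 11 L23–26).

THE CONSTRUCTION (everything through the tree's functoriality machinery, no new mathematics): `κ ∈ KS(S)` ↦
`KolyvaginSystem.toCoeff` ↦ restriction to the host levels `KolyvaginSystem.reindex (S.host hy 1) (S.refineStep hy)`
(`idxSeq_host`: the re-indexed setting reads `T` EXACTLY at `k = host(i+1)`) ↦ `CoeffTowerSetting.Hom.pushforward`
along **`refineHom`** — the morphism of tower settings «`S` at its hosts» → `(S.refine hy pins).toCoeffTowerSetting`
assembled from part A (level maps `proj`, maps of the Kolyvagin quotients, `f_red`/`fq_comp`/`fq_rq`, `cond_le`,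
and `fs_compat` for a TAME-PINNED source `htame`, the refined slots being tame by construction) ↦
`KolyvaginSystem.ofCoeff`.

WHAT IS PROVED (under the `letI`/`haveI` instance letters of `DVRSetting.refine`).
* §1 **`DVRSetting.refineHom S hy pins hPS htame : CoeffTowerSetting.Hom (RingHom.id R)
  (S.toCoeffTowerSetting.reindex (S.host hy 1) (S.refineStep hy)) (S.refine hy pins).toCoeffTowerSetting`**.
* §2 `reindex_primes_eq`, **`DVRSetting.refinePushforward S hy pins hPS htame κ : (S.refine hy pins).KolyvaginSystem`**,
  `refinePushforward_one` (`one♯ i = H¹(proj)(κ_1^{(host(i+1))})`, `rfl`),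
  **`refinePushforward_one_eq_refinedFamily : (…).one = S.refinedFamily hy κ.one`** (host independence, p698627),
  **`refinePushforward_one_ne_zero : κ.one ≠ 0 → (…).one ≠ 0`**.
With `refine_satisfiesH` (p700932), `refine_largePrimes_iff` / `largePrimes_refinedTower_iff` and this file, a
tame-pinned `DVRSetting` with H.0–H.5, `𝓛_s ⊂ 𝓛` and `κ_1 ≠ 0` yields the FULL setting `S♯` with the same three
hypotheses — the input shape of Howard's own proof of Thm. 1.6.1 (`T^{(k)} = T/𝔪^kT`).

HONEST FRAMING. The hypothesis `htame` (the source slots are the guarded tame slots of the same pin family) is the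
LEAD ruling of 2026-08-29 (general admissible slots are reduced to tame ones ONCE, at the `thm161` assembly,
x10b-p1-w7's (TAME-WLOG)); `thm161_dvrKolyvaginBound` is NOT proved (the full-tower theorem and the (COFINAL)
instantiation are other bricks); no summit statement is proved; the Birch–Swinnerton-Dyer conjecture is not proved
by any of this.
References: [Howard2004HeegnerKolyvagin] Rem. 1.2.4, Def. 1.2.3, §1.6 / Thm. 1.6.1.
-/

set_option autoImplicit false

noncomputable section

open Function NumberField IsDedekindDomain Field
open scoped NumberField TensorProduct

namespace Literature.NumberTheory.GaloisCohomology.Howard2004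

open Literature.NumberTheory.GaloisRepresentations
open Literature.NumberTheory.GaloisRepresentations.DiscreteGaloisModule

namespace DVRSetting

variable {p : ℕ} [Fact p.Prime] {K : Type} [Field K] [NumberField K]
  {R : Type} [CommRing R] [IsDomain R] [IsDiscreteValuationRing R] [Algebra ℤ_[p] R]
  {N : ℕ → Type} [∀ k, AddCommGroup (N k)] [∀ k, TopologicalSpace (N k)]
  [∀ k, DiscreteTopology (N k)] [∀ k, Module R (N k)]
  {Rk : ℕ → Type} [∀ k, CommRing (Rk k)] [∀ k, IsLocalRing (Rk k)] [∀ k, TopologicalSpace (Rk k)]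
  [∀ k, DiscreteTopology (Rk k)] [∀ k, Algebra ℤ_[p] (Rk k)] [∀ k, Algebra R (Rk k)]
  [∀ k, Module (Rk k) (N k)] [∀ k, IsScalarTower R (Rk k) (N k)]
  {Nbar : Type} [AddCommGroup Nbar] [TopologicalSpace Nbar] [DiscreteTopology Nbar]
  [∀ k, Module (Rk k) Nbar]
  {Nq : ℕ → Finset (HeightOneSpectrum (𝓞 K)) → Type} [∀ k n, AddCommGroup (Nq k n)]
  [∀ k n, TopologicalSpace (Nq k n)] [∀ k n, DiscreteTopology (Nq k n)]
  [∀ k n, Module (Rk k) (Nq k n)] [∀ k n, Module R (Nq k n)]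
  [∀ k n, IsScalarTower R (Rk k) (Nq k n)]

/-! ## §1 The morphism of tower settings «`S` at its hosts» → `S♯` -/

/-- **The morphism of tower settings from «`S` re-indexed along its host levels» to the refined setting `S♯`**
(over `id : R → R`): level maps `proj : T^{(host(i+1))} ↠ T/π^{i+1}T`, maps of the Kolyvagin quotients
`T^{(host)}/I_n ↠ (T/π^{i+1})/I_n`, the same `jbar`, `𝓛`; the target conditions ARE the images; the finite–singular
maps commute with the change because the source is TAME-PINNED (`htame`) like the target.
[cite: Howard2004HeegnerKolyvagin, Rem. 1.2.4 and §1.6 (arXiv p. 7 L13–27, p. 11 L33–47)] -/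
def refineHom (S : DVRSetting p K R N Rk Nbar Nq) (hy : S.SatisfiesH)
    (pins : ∀ v : HeightOneSpectrum (𝓞 K), TamePin v) [∀ k n, Finite (Nq k n)]
    (hPS : ∀ k n v, (n ∈ levels S.L ∧ v ∈ n) → TameHyp (S.LD k).ρq n v)
    (htame : ∀ k, (S.LD k).fs = tameSlotOn pins (S.LD k).ρq (fun n v => n ∈ levels S.L ∧ v ∈ n) (hPS k)) :
    letI : ∀ i, TopologicalSpace (S.QuotRing (i + 1)) := fun i => S.refineInstTop i
    haveI : ∀ i, DiscreteTopology (S.QuotRing (i + 1)) := fun i => S.refineInst_discrete i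
    haveI : ∀ i, IsLocalRing (S.QuotRing (i + 1)) := fun i => S.refineInst_isLocalRing hy i
    letI : ∀ i, Module (S.QuotRing (i + 1)) Nbar := fun i => S.residualModule hy i
    CoeffTowerSetting.Hom (RingHom.id R) (S.toCoeffTowerSetting.reindex (S.host hy 1) (S.refineStep hy))
      (S.refine hy pins).toCoeffTowerSetting :=
  letI : ∀ i, TopologicalSpace (S.QuotRing (i + 1)) := fun i => S.refineInstTop i
  haveI : ∀ i, DiscreteTopology (S.QuotRing (i + 1)) := fun i => S.refineInst_discrete i
  haveI : ∀ i, IsLocalRing (S.QuotRing (i + 1)) := fun i => S.refineInst_isLocalRing hy i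
  letI : ∀ i, Module (S.QuotRing (i + 1)) Nbar := fun i => S.residualModule hy i
  haveI : ∀ i m, Finite (LevelData.QuotCarrier (S.QuotRing (i + 1)) (S.refinedRep hy i) m) :=
    fun i m => S.finite_refinedQuotCarrier hy i m
  { f := fun i => S.refineF hy i
    f_smul := fun i r x => S.refineF_smul hy i r x
    f_equivariant := fun i σ x => S.refineF_equivariant hy i σ x
    f_red := fun i x => S.refineF_red hy i x
    fq := fun i n => (S.refineFq hy i n).toAddMonoidHom
    fq_comp := fun i n x => S.refineFq_comp hy i n x
    fq_equivariant := fun i n σ y => S.refineFq_equivariant hy i n σ y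
    fq_rq := fun i n y => S.refineFq_rq hy i n y
    jbar_eq := rfl
    primes_subset := subset_rfl
    cond_le := fun i v => (S.map_refineF_cond_eq hy i v).le
    fs_compat := fun i n v c _ => by
      have e2 := DFunLike.congr_fun (congrFun (congrFun (S.refinedLD_fs hy pins i) n) v)
        (localH1Map ((S.LD _).ρq n) (S.refinedQuotRep hy i n) v (S.refineFq hy i n).toAddMonoidHom
          (fun _ y => S.refineFq_equivariant hy i n _ y) c)
      exact e2.trans (S.refineFq_fs_compat hy pins hPS htame i n v c) }

/-! ## §2 The Kolyvagin system of the refined setting -/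

/-- The level triples of «`S` at its hosts» carry the prime set `𝓛` (for `Hom.pushforward`).
[cite: Howard2004HeegnerKolyvagin, §1.6 (arXiv p. 11, L15–16)] -/
theorem reindex_primes_eq (S : DVRSetting p K R N Rk Nbar Nq) (hy : S.SatisfiesH) (k : ℕ) :
    ((S.toCoeffTowerSetting.reindex (S.host hy 1) (S.refineStep hy)).t k).primes =
      (S.toCoeffTowerSetting.reindex (S.host hy 1) (S.refineStep hy)).L :=
  hy.primes_eq _

/-- **The pushforward of a Kolyvagin system of `S` to the refined setting `S♯`** (Rem. 1.2.4 along `refineHom`,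
after restricting `κ` to the host levels): level classes `κ♯^{(i)}_n = (H¹(fq_{i,n}) ⊗ 1) κ^{(host(i+1))}_n`, bottom
class `H¹(proj)(κ_1)`. [cite: Howard2004HeegnerKolyvagin, Rem. 1.2.4 and §1.6 (arXiv p. 7 L13–27, p. 11 L33–47: «we obtain, by Remark (functorality), a Kolyvagin system `κ^{(k)}`»)] -/
def refinePushforward (S : DVRSetting p K R N Rk Nbar Nq) (hy : S.SatisfiesH)
    (pins : ∀ v : HeightOneSpectrum (𝓞 K), TamePin v) [∀ k n, Finite (Nq k n)]
    (hPS : ∀ k n v, (n ∈ levels S.L ∧ v ∈ n) → TameHyp (S.LD k).ρq n v)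
    (htame : ∀ k, (S.LD k).fs = tameSlotOn pins (S.LD k).ρq (fun n v => n ∈ levels S.L ∧ v ∈ n) (hPS k))
    (κ : S.KolyvaginSystem) :
    letI : ∀ i, TopologicalSpace (S.QuotRing (i + 1)) := fun i => S.refineInstTop i
    haveI : ∀ i, DiscreteTopology (S.QuotRing (i + 1)) := fun i => S.refineInst_discrete i
    haveI : ∀ i, IsLocalRing (S.QuotRing (i + 1)) := fun i => S.refineInst_isLocalRing hy i
    letI : ∀ i, Module (S.QuotRing (i + 1)) Nbar := fun i => S.residualModule hy i
    (S.refine hy pins).KolyvaginSystem :=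
  letI : ∀ i, TopologicalSpace (S.QuotRing (i + 1)) := fun i => S.refineInstTop i
  haveI : ∀ i, DiscreteTopology (S.QuotRing (i + 1)) := fun i => S.refineInst_discrete i
  haveI : ∀ i, IsLocalRing (S.QuotRing (i + 1)) := fun i => S.refineInst_isLocalRing hy i
  letI : ∀ i, Module (S.QuotRing (i + 1)) Nbar := fun i => S.residualModule hy i
  KolyvaginSystem.ofCoeff ((S.refineHom hy pins hPS htame).pushforward (S.reindex_primes_eq hy)
    (fun i => S.refinedTriple_primes hy (i + 1))
    ((KolyvaginSystem.toCoeff κ).reindex (S.host hy 1) (S.refineStep hy)))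

/-- The bottom class of the pushforward at the refined level `i` is `H¹(proj)(κ_1^{(host(i+1))})`, read from the source
level `idxSeq … i = host(i+1)`. [cite: Howard2004HeegnerKolyvagin, Rem. 1.2.4 and §1.6 (arXiv p. 7 L13–27, p. 12 L29–33)] -/
theorem refinePushforward_one (S : DVRSetting p K R N Rk Nbar Nq) (hy : S.SatisfiesH)
    (pins : ∀ v : HeightOneSpectrum (𝓞 K), TamePin v) [∀ k n, Finite (Nq k n)]
    (hPS : ∀ k n v, (n ∈ levels S.L ∧ v ∈ n) → TameHyp (S.LD k).ρq n v)
    (htame : ∀ k, (S.LD k).fs = tameSlotOn pins (S.LD k).ρq (fun n v => n ∈ levels S.L ∧ v ∈ n) (hPS k))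
    (κ : S.KolyvaginSystem) (i : ℕ) :
    letI : ∀ i, TopologicalSpace (S.QuotRing (i + 1)) := fun i => S.refineInstTop i
    haveI : ∀ i, DiscreteTopology (S.QuotRing (i + 1)) := fun i => S.refineInst_discrete i
    haveI : ∀ i, IsLocalRing (S.QuotRing (i + 1)) := fun i => S.refineInst_isLocalRing hy i
    letI : ∀ i, Module (S.QuotRing (i + 1)) Nbar := fun i => S.residualModule hy i
    (S.refinePushforward hy pins hPS htame κ).one i =
      ((S.piRefinementDatum hy).isQuotientBy_levelRep (S.host_le_idxSeq hy i)).cohomologyMap 1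
        (κ.one (idxSeq (S.host hy 1) (S.refineStep hy) i)) :=
  rfl

/-- **The bottom class of the pushforward IS `refinedFamily κ_1`** (host independence of `H¹(proj)` on the compatible
family `κ_1 ∈ lim`). [cite: Howard2004HeegnerKolyvagin, §1.6 (arXiv p. 12 L29–33: `κ_1 ∈ H¹_F(K,T) = lim`)] -/
theorem refinePushforward_one_eq_refinedFamily (S : DVRSetting p K R N Rk Nbar Nq) (hy : S.SatisfiesH)
    (pins : ∀ v : HeightOneSpectrum (𝓞 K), TamePin v) [∀ k n, Finite (Nq k n)]
    (hPS : ∀ k n v, (n ∈ levels S.L ∧ v ∈ n) → TameHyp (S.LD k).ρq n v)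
    (htame : ∀ k, (S.LD k).fs = tameSlotOn pins (S.LD k).ρq (fun n v => n ∈ levels S.L ∧ v ∈ n) (hPS k))
    (κ : S.KolyvaginSystem) :
    letI : ∀ i, TopologicalSpace (S.QuotRing (i + 1)) := fun i => S.refineInstTop i
    haveI : ∀ i, DiscreteTopology (S.QuotRing (i + 1)) := fun i => S.refineInst_discrete i
    haveI : ∀ i, IsLocalRing (S.QuotRing (i + 1)) := fun i => S.refineInst_isLocalRing hy i
    letI : ∀ i, Module (S.QuotRing (i + 1)) Nbar := fun i => S.residualModule hy i
    (S.refinePushforward hy pins hPS htame κ).one = S.refinedFamily hy κ.one := by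
  funext i
  rw [refinePushforward_one, refinedFamily_apply]
  exact S.projH1_apply_of_mem_limitH1 hy ((AdicTower.mem_limitSelmer_iff _ _ _).mp κ.one_mem).1 _

/-- **`κ_1 ≠ 0 ⇒ κ♯_1 ≠ 0`** (the hypothesis of Thm. 1.6.1 survives the refinement).
[cite: Howard2004HeegnerKolyvagin, Thm. 1.6.1 (arXiv Thm. 2.6.1, p. 11 L23–26)] -/
theorem refinePushforward_one_ne_zero (S : DVRSetting p K R N Rk Nbar Nq) (hy : S.SatisfiesH)
    (pins : ∀ v : HeightOneSpectrum (𝓞 K), TamePin v) [∀ k n, Finite (Nq k n)]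
    (hPS : ∀ k n v, (n ∈ levels S.L ∧ v ∈ n) → TameHyp (S.LD k).ρq n v)
    (htame : ∀ k, (S.LD k).fs = tameSlotOn pins (S.LD k).ρq (fun n v => n ∈ levels S.L ∧ v ∈ n) (hPS k))
    (κ : S.KolyvaginSystem) (hone : κ.one ≠ 0) :
    letI : ∀ i, TopologicalSpace (S.QuotRing (i + 1)) := fun i => S.refineInstTop i
    haveI : ∀ i, DiscreteTopology (S.QuotRing (i + 1)) := fun i => S.refineInst_discrete i
    haveI : ∀ i, IsLocalRing (S.QuotRing (i + 1)) := fun i => S.refineInst_isLocalRing hy i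
    letI : ∀ i, Module (S.QuotRing (i + 1)) Nbar := fun i => S.residualModule hy i
    (S.refinePushforward hy pins hPS htame κ).one ≠ 0 := by
  rw [S.refinePushforward_one_eq_refinedFamily hy pins hPS htame κ]
  exact fun h0 =>
    hone (S.eq_zero_of_refinedFamily_eq_zero hy ((AdicTower.mem_limitSelmer_iff _ _ _).mp κ.one_mem).1 h0)

end DVRSetting

end Literature.NumberTheory.GaloisCohomology.Howard2004

end
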